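import Mathlib
import Summits.NavierStokesRegularity.NavierStokesRegularity.Theorems.EulerZoomLiouvillePowerGaugeEulerLiouvilleFarFieldSphereMean
import Summits.NavierStokesRegularity.NavierStokesRegularity.Theorems.EulerZoomLiouvillePowerGaugeEulerLiouvilleBallCap

/-!
# R49 plate 2.9, corollary: FAR SPHERES ARE NOT PRESSURISED ON AVERAGE (nsreg-p2 ROUND-49 «EVERY BALL BREATHES», the second sentence of
# `NsregP2.R49.FarFieldSphereMean`'s docstring made a theorem; seat ns-ezl-w2 g6, `--supports stmt-NavierStokesRegularity-19832 --as helper`)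

Under the hypotheses of `farFieldSphereMean` (γ-profile about the origin; (A)-budget `L^{2ρ−1}∫_{B_L}‖V‖² ≤ C` for `L ≥ 1`; (D)-budget
`∫|P|^{3/2}‖y‖^{2ρ−2} < ∞`; `0 < ρ < 1`):
* `setIntegral_normSq_div_cube_compl_ball_le` — the explicit dyadic tail `∫_{‖y‖≥r}‖U‖²‖y‖⁻³ ≤ (8/7)C r⁻³ + C(2r)^{1−2ρ}r⁻³/(1 − 2^{−2−2ρ})`
  (`r > 0`, `ρ > −1`; sum of the two geometric series behind `integrableOn_normSq_div_cube_compl_ball`);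
* `farField_sphereMean_abs_le` — `|sphereIntegral(V_n² + P)(r)| ≤ 2·(that tail)` for every `r > 0` (`farFieldSphereMean` with the
  derivative supplied by ns-sfl-p1 g8's `hasDerivAt_integral_ball_normalSq_add`, and `|3V_n² − ‖V‖²| ≤ 2‖V‖²`);
* `farField_spherePressure_le` — `sphereIntegral(P)(r) ≤ 2·(that tail)` (one-sided: `V_n² ≥ 0`);
* `farField_spherePressure_le_rpow` — for `ρ ≤ ½`: `sphereIntegral(P)(r) ≤ K·r^{−(2+2ρ)}` for all `r ≥ 1`, `K = 2C(8/7 + 2^{1−2ρ}/(1−2^{−2−2ρ}))`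
  — the sphere-wise pressure cap `⟨P⟩_{∂B_r(0)} ≤ C′ b(r)²`, `b(r) = r^{−(1+ρ)}` (HOOP-NOTE §1 CLASS READING, ns-idea-11 g8).

HONEST FRAMING: a ROUND-49 instrument inequality (class-free: budgets are hypotheses on a hypothetical profile); nothing about the crux E
(19832 OPEN) or NS regularity. [cite: ChaeWolf2016, Remark 2.3 (2.8); Chae2012, Theorem 1.2] [folklore]
-/

noncomputable section

set_option linter.dupNamespace false

open MeasureTheory Set Filter Topology Metric Function TopologicalSpace
open scoped ENNReal NNReal RealInnerProductSpace Topology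

namespace Summit.NavierStokesRegularity.NavierStokesRegularity.Theorems.PowerGaugeEulerLiouville

open Literature.Analysis Literature.Analysis.FunctionSpaces Literature.Analysis.FluidPDE

namespace ClassicalProfile

section Tail

variable {U : EuclideanSpace ℝ (Fin 3) → EuclideanSpace ℝ (Fin 3)}

/-- **The explicit dyadic tail**: under `∫_{B_L}‖U‖² ≤ C(1 + L^{1−2ρ})` (`L > 0`, `ρ > −1`), for every `r > 0`,
`∫_{‖y‖ ≥ r} ‖U‖²‖y‖⁻³ ≤ C r⁻³/(1 − 1/8) + C r⁻³ (2r)^{1−2ρ}/(1 − 2^{−2−2ρ})`. [folklore] -/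
theorem setIntegral_normSq_div_cube_compl_ball_le (hU : Continuous U) {C ρ r : ℝ} (hρ : -1 < ρ) (hr : 0 < r)
    (hE : ∀ L : ℝ, 0 < L → ∫ y in ball (0 : EuclideanSpace ℝ (Fin 3)) L, ‖U y‖ ^ 2 ≤ C * (1 + L ^ (1 - 2 * ρ))) :
    ∫ y in (ball (0 : EuclideanSpace ℝ (Fin 3)) r)ᶜ, ‖U y‖ ^ 2 / ‖y‖ ^ 3
      ≤ C * r⁻¹ ^ 3 * (1 - 1 / 8 : ℝ)⁻¹ + C * r⁻¹ ^ 3 * (2 * r) ^ (1 - 2 * ρ) * (1 - (2 : ℝ) ^ (-2 - 2 * ρ))⁻¹ := by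
  set s : ℕ → Set (EuclideanSpace ℝ (Fin 3)) := fun k => ball 0 (2 ^ (k + 1) * r) \ ball 0 (2 ^ k * r) with hs
  have hcover : (ball (0 : EuclideanSpace ℝ (Fin 3)) r)ᶜ = ⋃ k, s k := by
    ext y
    simp only [mem_compl_iff, mem_ball_zero_iff, not_lt, mem_iUnion, hs, Set.mem_sdiff]
    constructor
    · intro hy
      have hex : ∃ k : ℕ, ‖y‖ < 2 ^ (k + 1) * r := by
        obtain ⟨k, hk⟩ := pow_unbounded_of_one_lt (‖y‖ / r) (by norm_num : (1 : ℝ) < 2)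
        refine ⟨k, ?_⟩
        rw [div_lt_iff₀ hr] at hk
        calc ‖y‖ < 2 ^ k * r := hk
          _ ≤ 2 ^ (k + 1) * r := by
            apply mul_le_mul_of_nonneg_right _ hr.le
            exact pow_le_pow_right₀ (by norm_num) (Nat.le_succ k)
      classical
      refine ⟨Nat.find hex, Nat.find_spec hex, ?_⟩
      rcases Nat.eq_zero_or_pos (Nat.find hex) with h0 | hpos
      · rw [h0, pow_zero, one_mul]; exact hy
      · have hk := Nat.find_min hex (Nat.sub_one_lt_of_lt hpos)
        rw [not_lt, Nat.sub_add_cancel hpos] at hk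
        exact hk
    · rintro ⟨k, hk1, hk2⟩
      calc r = 2 ^ 0 * r := by simp
        _ ≤ 2 ^ k * r := mul_le_mul_of_nonneg_right (pow_le_pow_right₀ (by norm_num) (Nat.zero_le k)) hr.le
        _ ≤ ‖y‖ := hk2
  have hdisj : Pairwise (Disjoint on s) := by
    intro i j hij
    wlog hlt : i < j generalizing i j
    · exact (this hij.symm (lt_of_le_of_ne (not_lt.1 hlt) hij.symm)).symm
    rw [Function.onFun, Set.disjoint_left]
    intro y hyi hyj
    have h1 : ‖y‖ < 2 ^ (i + 1) * r := mem_ball_zero_iff.1 hyi.1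
    have h2 : (2 : ℝ) ^ j * r ≤ ‖y‖ := by
      have := hyj.2; rw [mem_ball_zero_iff, not_lt] at this; exact this
    have h3 : (2 : ℝ) ^ (i + 1) * r ≤ 2 ^ j * r :=
      mul_le_mul_of_nonneg_right (pow_le_pow_right₀ (by norm_num) (Nat.succ_le_of_lt hlt)) hr.le
    linarith
  have hI := integrableOn_normSq_div_cube_compl_ball hU hρ hr hE
  rw [hcover] at hI ⊢
  have hsum := hasSum_integral_iUnion (fun k => (measurableSet_ball.diff measurableSet_ball : MeasurableSet (s k))) hdisj hI
  -- the per-shell geometric bound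
  have hC : 0 ≤ C := by
    have h := hE 1 one_pos
    rw [Real.one_rpow] at h
    have h0 : 0 ≤ ∫ y in ball (0 : EuclideanSpace ℝ (Fin 3)) 1, ‖U y‖ ^ 2 := setIntegral_nonneg measurableSet_ball fun y _ => sq_nonneg _
    linarith
  have hbound : ∀ k : ℕ, ∫ y in s k, ‖U y‖ ^ 2 / ‖y‖ ^ 3
      ≤ C * r⁻¹ ^ 3 * (1 / 8 : ℝ) ^ k + C * r⁻¹ ^ 3 * (2 * r) ^ (1 - 2 * ρ) * ((2 : ℝ) ^ (-2 - 2 * ρ)) ^ k := by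
    intro k
    have h2k : 0 < (2 : ℝ) ^ k * r := by positivity
    have hIk := integrableOn_normSq_div_cube_shell hU h2k (2 ^ (k + 1) * r)
    have hpt : ∀ y ∈ s k, ‖U y‖ ^ 2 / ‖y‖ ^ 3 ≤ ((2 : ℝ) ^ k * r)⁻¹ ^ 3 * ‖U y‖ ^ 2 := by
      intro y hy
      have hy2 : (2 : ℝ) ^ k * r ≤ ‖y‖ := by
        have := hy.2; rw [mem_ball_zero_iff, not_lt] at this; exact this
      have hypos : 0 < ‖y‖ := h2k.trans_le hy2
      rw [div_eq_mul_inv, mul_comm, ← inv_pow]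
      exact mul_le_mul_of_nonneg_right (pow_le_pow_left₀ (inv_nonneg.2 hypos.le) ((inv_le_inv₀ hypos h2k).2 hy2) 3) (sq_nonneg _)
    have hmono := setIntegral_mono_on hIk (((hU.norm.pow 2).continuousOn.integrableOn_compact
        (isCompact_closedBall (0 : EuclideanSpace ℝ (Fin 3)) (2 ^ (k + 1) * r))).mono_set
        (fun y hy => ball_subset_closedBall hy.1) |>.const_mul _) (measurableSet_ball.diff measurableSet_ball) hpt
    rw [integral_const_mul] at hmono
    have hsub : ∫ y in s k, ‖U y‖ ^ 2 ≤ ∫ y in ball (0 : EuclideanSpace ℝ (Fin 3)) (2 ^ (k + 1) * r), ‖U y‖ ^ 2 :=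
      setIntegral_mono_set (((hU.norm.pow 2).continuousOn.integrableOn_compact (isCompact_closedBall 0 _)).mono_set
        ball_subset_closedBall) (ae_of_all _ fun y => sq_nonneg _) (ae_of_all _ fun y hy => hy.1)
    have hEk := hE (2 ^ (k + 1) * r) (by positivity)
    have hinv : 0 ≤ ((2 : ℝ) ^ k * r)⁻¹ ^ 3 := by positivity
    have e1 : ((2 : ℝ) ^ k * r)⁻¹ ^ 3 = r⁻¹ ^ 3 * (1 / 8 : ℝ) ^ k := by
      rw [mul_inv, mul_pow, ← inv_pow, ← pow_mul, mul_comm k 3, pow_mul]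
      norm_num
      ring
    have e2 : ((2 : ℝ) ^ (k + 1) * r) ^ (1 - 2 * ρ) = (2 * r) ^ (1 - 2 * ρ) * ((2 : ℝ) ^ (1 - 2 * ρ)) ^ k := by
      rw [pow_succ, mul_assoc, mul_comm ((2 : ℝ) ^ k), Real.mul_rpow (by positivity) (by positivity), ← Real.rpow_natCast,
        ← Real.rpow_mul (by norm_num), mul_comm (k : ℝ), Real.rpow_mul (by norm_num), Real.rpow_natCast]
    have e3 : (1 / 8 : ℝ) ^ k * ((2 : ℝ) ^ (1 - 2 * ρ)) ^ k = ((2 : ℝ) ^ (-2 - 2 * ρ)) ^ k := by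
      rw [← mul_pow]
      congr 1
      rw [show (1 / 8 : ℝ) = (2 : ℝ) ^ (-3 : ℝ) by norm_num [Real.rpow_neg, Real.rpow_natCast], ← Real.rpow_add (by norm_num)]
      ring_nf
    calc ∫ y in s k, ‖U y‖ ^ 2 / ‖y‖ ^ 3
        ≤ ((2 : ℝ) ^ k * r)⁻¹ ^ 3 * ∫ y in s k, ‖U y‖ ^ 2 := hmono
      _ ≤ ((2 : ℝ) ^ k * r)⁻¹ ^ 3 * (C * (1 + ((2 : ℝ) ^ (k + 1) * r) ^ (1 - 2 * ρ))) :=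
          mul_le_mul_of_nonneg_left (hsub.trans hEk) hinv
      _ = C * r⁻¹ ^ 3 * (1 / 8 : ℝ) ^ k + C * r⁻¹ ^ 3 * (2 * r) ^ (1 - 2 * ρ) * ((2 : ℝ) ^ (-2 - 2 * ρ)) ^ k := by
          rw [e1, e2, ← e3]; ring
  -- sum the geometric majorant
  have hq1 : (2 : ℝ) ^ (-2 - 2 * ρ) < 1 := Real.rpow_lt_one_of_one_lt_of_neg (by norm_num) (by linarith)
  have hq0 : 0 ≤ (2 : ℝ) ^ (-2 - 2 * ρ) := Real.rpow_nonneg (by norm_num) _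
  have hmaj : HasSum (fun k : ℕ => C * r⁻¹ ^ 3 * (1 / 8 : ℝ) ^ k + C * r⁻¹ ^ 3 * (2 * r) ^ (1 - 2 * ρ) * ((2 : ℝ) ^ (-2 - 2 * ρ)) ^ k)
      (C * r⁻¹ ^ 3 * (1 - 1 / 8 : ℝ)⁻¹ + C * r⁻¹ ^ 3 * (2 * r) ^ (1 - 2 * ρ) * (1 - (2 : ℝ) ^ (-2 - 2 * ρ))⁻¹) :=
    ((hasSum_geometric_of_lt_one (by norm_num) (by norm_num)).mul_left _).add
      ((hasSum_geometric_of_lt_one hq0 hq1).mul_left _)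
  exact hasSum_le hbound hsum hmaj

end Tail

/-! ## Far spheres are not pressurised on average -/

section Pressure

variable {γ ρ : ℝ} {V : EuclideanSpace ℝ (Fin 3) → EuclideanSpace ℝ (Fin 3)} {P : EuclideanSpace ℝ (Fin 3) → ℝ}

/-- **Two-sided far-field bound on the sphere means of `V_n² + P`**: under the hypotheses of `farFieldSphereMean`, for every `r > 0`,
`|sphereIntegral(V_n² + P)(r)| ≤ 2·∫_{‖y‖≥r}‖V‖²‖y‖⁻³ ≤ 2C r⁻³/(1−1/8) + 2C r⁻³(2r)^{1−2ρ}/(1−2^{−2−2ρ})`. [folklore] -/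
theorem farField_sphereMean_abs_le (hρ0 : 0 < ρ) (hρ1 : ρ < 1) (hprof : IsSelfSimilarEulerProfile γ 0 V P) {C : ℝ}
    (hA : ∀ L : ℝ, 1 ≤ L → L ^ (2 * ρ - 1) * ∫ y in ball (0 : EuclideanSpace ℝ (Fin 3)) L, ‖V y‖ ^ 2 ≤ C)
    (hD : Integrable (fun y : EuclideanSpace ℝ (Fin 3) => |P y| ^ (3 / 2 : ℝ) * ‖y‖ ^ (2 * ρ - 2))) {r : ℝ} (hr : 0 < r) :
    |sphereIntegral volume (fun z : EuclideanSpace ℝ (Fin 3) => ⟪V z, z⟫ ^ 2 / ‖z‖ ^ 2 + P z) r|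
      ≤ 2 * (C * r⁻¹ ^ 3 * (1 - 1 / 8 : ℝ)⁻¹ + C * r⁻¹ ^ 3 * (2 * r) ^ (1 - 2 * ρ) * (1 - (2 : ℝ) ^ (-2 - 2 * ρ))⁻¹) := by
  have hV : Continuous V := hprof.contDiff_velocity.continuous
  have hP : Continuous P := hprof.contDiff_pressure.continuous
  have hE : ∀ L : ℝ, 0 < L → ∫ y in ball (0 : EuclideanSpace ℝ (Fin 3)) L, ‖V y‖ ^ 2 ≤ C * (1 + L ^ (1 - 2 * ρ)) :=
    fun L hL => integral_ball_normSq_le_of_budget hV hA hL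
  -- the identity at radius `r`
  have hder := hasDerivAt_integral_ball_normalSq_add hV hP (0 : EuclideanSpace ℝ (Fin 3)) hr
  simp only [sub_zero, add_zero] at hder
  have hFF := farFieldSphereMean γ ρ hρ0 hρ1 V P hprof ⟨C, hA⟩ hD r _ hr hder
  have hsph := sphereIntegral_normalSq_eq (V := V) (P := P) (0 : EuclideanSpace ℝ (Fin 3)) hr
  simp only [add_zero] at hsph
  have hπ : 0 < Real.pi := Real.pi_pos
  have hid : sphereIntegral volume (fun z : EuclideanSpace ℝ (Fin 3) => ⟪V z, z⟫ ^ 2 / ‖z‖ ^ 2 + P z) r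
      = ∫ y in (ball (0 : EuclideanSpace ℝ (Fin 3)) r)ᶜ, (3 * ⟪V y, y⟫ ^ 2 / ‖y‖ ^ 2 - ‖V y‖ ^ 2) / ‖y‖ ^ 3 := by
    rw [hsph]
    have hr2 : r ^ 2 ≠ 0 := by positivity
    field_simp at hFF
    nlinarith [hFF, hπ, sq_nonneg r]
  -- `|∫ g| ≤ 2 ∫ ‖V‖²‖y‖⁻³`
  have hI := integrableOn_normSq_div_cube_compl_ball hV (by linarith) hr hE
  have hgI := integrableOn_twoSphereIntegrand_compl_ball hV (by linarith) hr hE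
  have habs : |∫ y in (ball (0 : EuclideanSpace ℝ (Fin 3)) r)ᶜ, (3 * ⟪V y, y⟫ ^ 2 / ‖y‖ ^ 2 - ‖V y‖ ^ 2) / ‖y‖ ^ 3|
      ≤ ∫ y in (ball (0 : EuclideanSpace ℝ (Fin 3)) r)ᶜ, 2 * (‖V y‖ ^ 2 / ‖y‖ ^ 3) := by
    refine (abs_integral_le_integral_abs).trans (setIntegral_mono_on hgI.abs (hI.const_mul 2) measurableSet_ball.compl fun y hy => ?_)
    have hy0 : 0 < ‖y‖ := by
      have h1 : ¬ ‖y‖ < r := fun h => hy (mem_ball_zero_iff.2 h)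
      linarith
    have hy3 : 0 < ‖y‖ ^ 3 := pow_pos hy0 3
    have hN0 : 0 ≤ ⟪V y, y⟫ ^ 2 / ‖y‖ ^ 2 := div_nonneg (sq_nonneg _) (sq_nonneg _)
    have hN1 : ⟪V y, y⟫ ^ 2 / ‖y‖ ^ 2 ≤ ‖V y‖ ^ 2 := by
      rw [div_le_iff₀ (pow_pos hy0 2)]
      have hcs := abs_real_inner_le_norm (V y) y
      have h0 : 0 ≤ |⟪V y, y⟫| := abs_nonneg _
      nlinarith [sq_abs ⟪V y, y⟫, norm_nonneg (V y), norm_nonneg y, mul_nonneg (norm_nonneg (V y)) (norm_nonneg y)]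
    rw [abs_div, abs_of_pos hy3, div_le_iff₀ hy3]
    have e : 2 * (‖V y‖ ^ 2 / ‖y‖ ^ 3) * ‖y‖ ^ 3 = 2 * ‖V y‖ ^ 2 := by field_simp
    rw [e, show 3 * ⟪V y, y⟫ ^ 2 / ‖y‖ ^ 2 = 3 * (⟪V y, y⟫ ^ 2 / ‖y‖ ^ 2) by ring]
    exact abs_le.2 ⟨by nlinarith, by nlinarith⟩
  rw [integral_const_mul] at habs
  have htail := setIntegral_normSq_div_cube_compl_ball_le hV (by linarith : (-1 : ℝ) < ρ) hr hE
  rw [hid]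
  linarith

/-- **FAR SPHERES ARE NOT PRESSURISED ON AVERAGE** (one-sided): under the hypotheses of `farFieldSphereMean`, for every `r > 0`,
`sphereIntegral(P)(r) ≤ 2C r⁻³/(1−1/8) + 2C r⁻³(2r)^{1−2ρ}/(1−2^{−2−2ρ})` (`sphereIntegral = 4π ×` the sphere mean; `V_n² ≥ 0`). [folklore] -/
theorem farField_spherePressure_le (hρ0 : 0 < ρ) (hρ1 : ρ < 1) (hprof : IsSelfSimilarEulerProfile γ 0 V P) {C : ℝ}
    (hA : ∀ L : ℝ, 1 ≤ L → L ^ (2 * ρ - 1) * ∫ y in ball (0 : EuclideanSpace ℝ (Fin 3)) L, ‖V y‖ ^ 2 ≤ C)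
    (hD : Integrable (fun y : EuclideanSpace ℝ (Fin 3) => |P y| ^ (3 / 2 : ℝ) * ‖y‖ ^ (2 * ρ - 2))) {r : ℝ} (hr : 0 < r) :
    sphereIntegral volume P r
      ≤ 2 * (C * r⁻¹ ^ 3 * (1 - 1 / 8 : ℝ)⁻¹ + C * r⁻¹ ^ 3 * (2 * r) ^ (1 - 2 * ρ) * (1 - (2 : ℝ) ^ (-2 - 2 * ρ))⁻¹) := by
  have hV : Continuous V := hprof.contDiff_velocity.continuous
  have hP : Continuous P := hprof.contDiff_pressure.continuous
  have h := farField_sphereMean_abs_le hρ0 hρ1 hprof hA hD hr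
  have hsplit := sphereIntegral_normalSq_add_eq_add (U := V) (Q := P) hV hP (0 : EuclideanSpace ℝ (Fin 3)) hr
  simp only [add_zero] at hsplit
  have hN : 0 ≤ sphereIntegral volume (fun z : EuclideanSpace ℝ (Fin 3) => ⟪V z, z⟫ ^ 2 / ‖z‖ ^ 2) r := by
    rw [sphereIntegral_def]
    exact integral_nonneg fun θ => div_nonneg (sq_nonneg _) (sq_nonneg _)
  have hPeq : sphereIntegral volume P r = sphereIntegral volume (fun z : EuclideanSpace ℝ (Fin 3) => P z) r := rfl
  rw [hPeq]
  linarith [(abs_le.1 h).2]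

/-- **The sphere-wise pressure cap** (`⟨P⟩_{∂B_r(0)} ≤ C′ r^{−2−2ρ}`, HOOP-NOTE §1 CLASS READING): under the hypotheses of
`farFieldSphereMean` with `ρ ≤ ½`, for all `r ≥ 1`, `sphereIntegral(P)(r) ≤ K·r^{−(2+2ρ)}` with
`K = 2C(8/7 + 2^{1−2ρ}/(1 − 2^{−2−2ρ}))`. [folklore] -/
theorem farField_spherePressure_le_rpow (hρ0 : 0 < ρ) (hρh : ρ ≤ 1 / 2) (hprof : IsSelfSimilarEulerProfile γ 0 V P) {C : ℝ}
    (hA : ∀ L : ℝ, 1 ≤ L → L ^ (2 * ρ - 1) * ∫ y in ball (0 : EuclideanSpace ℝ (Fin 3)) L, ‖V y‖ ^ 2 ≤ C)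
    (hD : Integrable (fun y : EuclideanSpace ℝ (Fin 3) => |P y| ^ (3 / 2 : ℝ) * ‖y‖ ^ (2 * ρ - 2))) {r : ℝ} (hr : 1 ≤ r) :
    sphereIntegral volume P r
      ≤ 2 * C * ((1 - 1 / 8 : ℝ)⁻¹ + (2 : ℝ) ^ (1 - 2 * ρ) * (1 - (2 : ℝ) ^ (-2 - 2 * ρ))⁻¹) * r ^ (-(2 + 2 * ρ)) := by
  have hr0 : 0 < r := by linarith
  have h := farField_spherePressure_le hρ0 (by linarith) hprof hA hD hr0
  have hV : Continuous V := hprof.contDiff_velocity.continuous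
  have hC : 0 ≤ C := by
    have h1 := hA 1 le_rfl
    rw [Real.one_rpow, one_mul] at h1
    exact (setIntegral_nonneg measurableSet_ball fun y _ => sq_nonneg _).trans h1
  have hq1 : (2 : ℝ) ^ (-2 - 2 * ρ) < 1 := Real.rpow_lt_one_of_one_lt_of_neg (by norm_num) (by linarith)
  have hq0 : 0 ≤ (2 : ℝ) ^ (-2 - 2 * ρ) := Real.rpow_nonneg (by norm_num) _
  have hgeo : 0 ≤ (1 - (2 : ℝ) ^ (-2 - 2 * ρ))⁻¹ := inv_nonneg.2 (by linarith)
  -- `r⁻³ ≤ r^{−(2+2ρ)}` and `r⁻³(2r)^{1−2ρ} = 2^{1−2ρ} r^{−(2+2ρ)}` for `r ≥ 1`, `ρ ≤ ½`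
  have e1 : r⁻¹ ^ 3 * (2 * r) ^ (1 - 2 * ρ) = (2 : ℝ) ^ (1 - 2 * ρ) * r ^ (-(2 + 2 * ρ)) := by
    rw [Real.mul_rpow (by norm_num) hr0.le, inv_pow, ← Real.rpow_natCast r 3, ← Real.rpow_neg hr0.le]
    have e : r ^ (-((3 : ℕ) : ℝ)) * r ^ (1 - 2 * ρ) = r ^ (-(2 + 2 * ρ)) := by
      rw [← Real.rpow_add hr0]; norm_num; ring_nf
    push_cast at e ⊢
    linear_combination (2 : ℝ) ^ (1 - 2 * ρ) * e
  have e2 : r⁻¹ ^ 3 ≤ r ^ (-(2 + 2 * ρ)) := by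
    rw [inv_pow, ← Real.rpow_natCast r 3, ← Real.rpow_neg hr0.le]
    exact Real.rpow_le_rpow_of_exponent_le hr (by push_cast; linarith)
  have hpos8 : 0 ≤ C * (1 - 1 / 8 : ℝ)⁻¹ := by positivity
  calc sphereIntegral volume P r
      ≤ 2 * (C * r⁻¹ ^ 3 * (1 - 1 / 8 : ℝ)⁻¹ + C * r⁻¹ ^ 3 * (2 * r) ^ (1 - 2 * ρ) * (1 - (2 : ℝ) ^ (-2 - 2 * ρ))⁻¹) := h
    _ = 2 * (C * (1 - 1 / 8 : ℝ)⁻¹ * r⁻¹ ^ 3 + C * (2 : ℝ) ^ (1 - 2 * ρ) * (1 - (2 : ℝ) ^ (-2 - 2 * ρ))⁻¹ * r ^ (-(2 + 2 * ρ))) := by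
        linear_combination (2 * C * (1 - (2 : ℝ) ^ (-2 - 2 * ρ))⁻¹) * e1
    _ ≤ 2 * (C * (1 - 1 / 8 : ℝ)⁻¹ * r ^ (-(2 + 2 * ρ)) + C * (2 : ℝ) ^ (1 - 2 * ρ) * (1 - (2 : ℝ) ^ (-2 - 2 * ρ))⁻¹ * r ^ (-(2 + 2 * ρ))) := by
        nlinarith [mul_le_mul_of_nonneg_left e2 hpos8]
    _ = _ := by ring

end Pressure

end ClassicalProfile

end Summit.NavierStokesRegularity.NavierStokesRegularity.Theorems.PowerGaugeEulerLiouville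

end
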